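import Summits.BirchSwinnertonDyer.BirchSwinnertonDyer.Theorems.ManinLocalTwoThreeManinOddAtFourDyadicTwistConductor
import Summits.BirchSwinnertonDyer.BirchSwinnertonDyer.Theorems.ManinLocalTwoThreeManinOddAtFourEtaTwo
import Summits.BirchSwinnertonDyer.BirchSwinnertonDyer.Theorems.ManinLocalTwoThreeManinPrimeToThreeAtNineTwistCovered
import Summits.BirchSwinnertonDyer.BirchSwinnertonDyer.Theses.ManinLocalTwoThree
import Summits.BirchSwinnertonDyer.Rank1Residual.ManinAdditive.TwoNotDvdManinOfTwistAtTwoEdges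
import HarnessLib

/-!
# Route `ManinLocalTwoThree` (cell `bsd-f2-manin`), cruxes C2 `ManinOddAtFour` (stmt-BirchSwinnertonDyer-22967)
# and C3 `ManinPrimeToThreeAtNine` (stmt-BirchSwinnertonDyer-22968): the TWIST-COVERED halves are
# THEOREMS, and each crux is REDUCED to its single twist-minimal stub

Assembly of the landed stubs of the registered lines `dyadic-twist` (C2) and `ternary-twist` (C3):
* `maninLocalTwoThree_maninOddAtFour_twistCovered` — VERBATIM the birth-line stub
  `stub_twistCoveredAtTwo` of C2, PROVED: modulo the four printed facts, every globally minimal `W/ℚ`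
  with a lattice-optimal `X₀(N)`-datum `D`, `4 ∣ N`, whose class is a `χ_d`-twist (`d ∈ {−1, 2, −2}`)
  of a class semistable at `2` (`W ∼ W' ⊗ ℚ(√d)`, `W'` globally minimal, `4 ∤ N(W')`) has
  `2 ∤ D.maninConstant`. Ingredients: the conductor bookkeeping `stub_dyadicTwistConductor` (seat p2,
  `ManinLocalTwoThreeManinOddAtFourDyadicTwistConductor`), the `η = 2` law E-an-1
  `twoNotDvdManinOfTwistEtaTwo_holds` (seat p3, `ManinLocalTwoThreeManinOddAtFourEtaTwo`, beyond print:
  Stevens' excluded case) through the union law E-an-2 `twoNotDvdManinOfTwistOfSemistableAtTwo_holds`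
  (tree `η = 1` theorem inside), the level-is-conductor identification (`hnf`) and additivity at `2`.
* `maninLocalTwoThree_maninOddAtFour_of_twistMinimalAtTwo` — **C2 ⟸ `stub_twistMinimalAtTwo` ALONE**
  (the registered twist-minimal stub, verbatim as hypothesis; kernel-checked composition).
* `maninLocalTwoThree_maninPrimeToThreeAtNine_of_twistMinimalAtThree` — **C3 ⟸ the birth stub
  `stub_twistMinimalAtThree` ALONE** (twist-covered half = the landed
  `maninLocalTwoThree_maninPrimeToThreeAtNine_twistCovered`), and
  `maninLocalTwoThree_maninPrimeToThreeAtNine_of_twistMinimalAtThree_split` — C3 ⟸ the two registered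
  `ternary-twist` stubs `stub_twistMinimalAtThree_irreducible` + `stub_twistMinimalAtThree_reducible`.
So after this file the open content of the route's two attacked cruxes is EXACTLY Manin's conjecture at
`2` resp. `3` on the TWIST-MINIMAL additive classes (potentially good at `p` with semistability defect
`e_p > 2`; no printed theorem, no cell mechanism yet). Nothing here proves BSD or Manin's conjecture.
Seat bsd-line-manin23-p2 (prover).

References: [Stevens1989] Lemmas (5.2), (5.4), (5.6)–(5.7); [Cesnavicius2018] Thm. 1.2; [AtkinLi1978]
Thm. 3.1; [SilvermanATAEC1994] IV.11.1.
-/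

set_option autoImplicit false
set_option linter.dupNamespace false

noncomputable section

namespace Summit.BirchSwinnertonDyer.BirchSwinnertonDyer.Theorems

open WeierstrassCurve Literature.NumberTheory.EllipticCurves Literature.NumberTheory.EllipticCurves.ModularForms
  Summit.BirchSwinnertonDyer.Rank1Residual.ManinAdditive

/-! ## C2: the twist-covered half of `ManinOddAtFour` is a theorem -/

/-- **Birth-line STUB 1 `stub_twistCoveredAtTwo` of crux `ManinOddAtFour` (stmt-BirchSwinnertonDyer-22967),
PROVED verbatim**: modulo the printed semistable-prime Manin facts and modularity, for every globally
minimal `W/ℚ`, every lattice-optimal `X₀(N)`-datum `D` with `4 ∣ N`: if the class of `W` is the twist by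
`d ∈ {−1, 2, −2}` of a class semistable at `2` (`W ∼ W' ⊗ ℚ(√d)`, `W'` globally minimal, `4 ∤ N(W')`),
then `2 ∤ D.maninConstant`. Level = conductor (`hnf`) gives additivity of `W` at `2`;
`stub_dyadicTwistConductor` gives `N(W') ∣ N(W)` and `(4|d|)² ∣ N(W)`; then the union law E-an-2
(`twoNotDvdManinOfTwistOfSemistableAtTwo_holds`: the tree's `η = 1` theorem and the landed `η = 2` law
E-an-1). [cite: Stevens1989, Lemmas (5.2), (5.4), (5.6)–(5.7)] [cite: Cesnavicius2018, Thm. 1.2] -/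
theorem maninLocalTwoThree_maninOddAtFour_twistCovered :
    Literature.NumberTheory.EllipticCurves.ModularForms.mazur_not_dvd_maninConstant_of_odd →
    Literature.NumberTheory.EllipticCurves.ModularForms.abbesUllmo_not_dvd_maninConstant_of_not_dvd_level →
    Literature.NumberTheory.EllipticCurves.ModularForms.cesnavicius_not_two_dvd_maninConstant_of_two_dvd_level →
    Literature.NumberTheory.EllipticCurves.ModularForms.exists_isNewformOf →
    ∀ (W : WeierstrassCurve ℚ) [W.IsElliptic] [W.IsGloballyMinimal] {N : ℕ} [NeZero N]
      (D : ModularParametrizationData W N),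
      (∀ z ∈ D.L.lattice, ∃ w ∈ periodLattice D.f, z = D.c * w) → 2 ^ 2 ∣ N →
      (∃ (W' : WeierstrassCurve ℚ) (d : ℤ), W'.IsElliptic ∧ W'.IsGloballyMinimal ∧
        (d = -1 ∨ d = 2 ∨ d = -2) ∧ IsIsogenous W (W'.quadraticTwist (d : ℚ)) ∧
        ¬ 2 ^ 2 ∣ W'.conductorNorm ℤ) →
      ¬ (2 : ℤ) ∣ D.maninConstant := by
  intro hM hAU hC2 hnf W _ _ N _ D hopt h4 hex
  obtain ⟨W', d, hE', hM', hd, htw, h4'⟩ := hex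
  haveI := hE'
  haveI := hM'
  have hN : N = W.conductorNorm ℤ :=
    IsNewformOf.level_eq_conductorNorm_of_exists_isNewformOf hnf D.isNewformOf
  have hadd : ¬ W.HasGoodReductionAtPrime 2 ∧ ¬ W.HasMultiplicativeReductionAtPrime 2 :=
    Summit.BirchSwinnertonDyer.Rank1Residual.ManinAdditive.not_good_and_not_mult_of_sq_dvd_conductorNorm
      W (hN ▸ h4)
  obtain ⟨hN'N, hmN⟩ := stub_dyadicTwistConductor hnf hd htw h4' hadd
  exact twoNotDvdManinOfTwistOfSemistableAtTwo_holds hM hAU hC2 hnf hd htw hN'N hmN h4' hadd W D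
    (isIsogenous_self W) hopt

/-- **Crux C2 `ManinOddAtFour` ⟸ the twist-minimal stub ALONE.** With the twist-covered half proved
(`maninLocalTwoThree_maninOddAtFour_twistCovered`), the registered stub `stub_twistMinimalAtTwo` of the
lines `birth` / `dyadic-twist` (verbatim as the hypothesis) implies the route decl BY NAME: excluded
middle on the dyadic twist predicate. What `stub_twistMinimalAtTwo` asks is Manin's conjecture at `2`
for the optimal curves with `4 ∣ N` whose class is NOT a `χ₋₄/χ_{±8}`-twist of a `2`-semistable class
(potentially good at `2` with semistability defect `e₂ ∈ {3, 4, 6, 8, 24}`) — OPEN, no printed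
theorem. [cite: Stevens1989, Lemmas (5.2), (5.4)] [cite: CesnaviciusNeururerSaha2023, Thm. 1.2] -/
theorem maninLocalTwoThree_maninOddAtFour_of_twistMinimalAtTwo
    (h₂ : Literature.NumberTheory.EllipticCurves.ModularForms.mazur_not_dvd_maninConstant_of_odd →
      Literature.NumberTheory.EllipticCurves.ModularForms.abbesUllmo_not_dvd_maninConstant_of_not_dvd_level →
      Literature.NumberTheory.EllipticCurves.ModularForms.cesnavicius_not_two_dvd_maninConstant_of_two_dvd_level →
      Literature.NumberTheory.EllipticCurves.ModularForms.exists_isNewformOf →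
      ∀ (W : WeierstrassCurve ℚ) [W.IsElliptic] [W.IsGloballyMinimal] {N : ℕ} [NeZero N]
        (D : ModularParametrizationData W N),
        (∀ z ∈ D.L.lattice, ∃ w ∈ periodLattice D.f, z = D.c * w) → 2 ^ 2 ∣ N →
        ¬ (∃ (W' : WeierstrassCurve ℚ) (d : ℤ), W'.IsElliptic ∧ W'.IsGloballyMinimal ∧
          (d = -1 ∨ d = 2 ∨ d = -2) ∧ IsIsogenous W (W'.quadraticTwist (d : ℚ)) ∧
          ¬ 2 ^ 2 ∣ W'.conductorNorm ℤ) →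
        ¬ (2 : ℤ) ∣ D.maninConstant) :
    Summit.BirchSwinnertonDyer.BirchSwinnertonDyer.Theses.ManinLocalTwoThree.ManinOddAtFour := by
  intro hM hAU hC hnf W _ _ N _ D hopt h4
  by_cases hex : (∃ (W' : WeierstrassCurve ℚ) (d : ℤ), W'.IsElliptic ∧ W'.IsGloballyMinimal ∧
      (d = -1 ∨ d = 2 ∨ d = -2) ∧ IsIsogenous W (W'.quadraticTwist (d : ℚ)) ∧
      ¬ 2 ^ 2 ∣ W'.conductorNorm ℤ)
  · exact maninLocalTwoThree_maninOddAtFour_twistCovered hM hAU hC hnf W D hopt h4 hex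
  · exact h₂ hM hAU hC hnf W D hopt h4 hex

/-! ## C3: `ManinPrimeToThreeAtNine` ⟸ the twist-minimal stub(s) ALONE -/

/-- **Crux C3 `ManinPrimeToThreeAtNine` ⟸ the birth-line twist-minimal stub `stub_twistMinimalAtThree`
ALONE** (the twist-covered half is the landed `maninLocalTwoThree_maninPrimeToThreeAtNine_twistCovered`):
excluded middle on the `χ₋₃` twist predicate. What the stub asks is Manin's conjecture at `3` for the
optimal curves with `9 ∣ N` whose class is NOT the `χ₋₃`-twist of a `3`-semistable class (`27 ∣ N`, or
`9 ∥ N` twist-minimal) — OPEN. [cite: Stevens1989, Lemmas (5.2), (5.4)]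
[cite: CesnaviciusNeururerSaha2023, Thm. 1.2] -/
theorem maninLocalTwoThree_maninPrimeToThreeAtNine_of_twistMinimalAtThree
    (h₂ : Literature.NumberTheory.EllipticCurves.ModularForms.mazur_not_dvd_maninConstant_of_odd →
      Literature.NumberTheory.EllipticCurves.ModularForms.abbesUllmo_not_dvd_maninConstant_of_not_dvd_level →
      Literature.NumberTheory.EllipticCurves.ModularForms.cesnavicius_not_two_dvd_maninConstant_of_two_dvd_level →
      Literature.NumberTheory.EllipticCurves.ModularForms.exists_isNewformOf →
      ∀ (W : WeierstrassCurve ℚ) [W.IsElliptic] [W.IsGloballyMinimal] {N : ℕ} [NeZero N]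
        (D : ModularParametrizationData W N),
        (∀ z ∈ D.L.lattice, ∃ w ∈ periodLattice D.f, z = D.c * w) → 3 ^ 2 ∣ N →
        ¬ (∃ (W' : WeierstrassCurve ℚ) (d : ℤ), W'.IsElliptic ∧ W'.IsGloballyMinimal ∧
          (d = -3) ∧ IsIsogenous W (W'.quadraticTwist (d : ℚ)) ∧
          ¬ 3 ^ 2 ∣ W'.conductorNorm ℤ) →
        ¬ (3 : ℤ) ∣ D.maninConstant) :
    Summit.BirchSwinnertonDyer.BirchSwinnertonDyer.Theses.ManinLocalTwoThree.ManinPrimeToThreeAtNine := by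
  intro hM hAU hC hnf W _ _ N _ D hopt h9
  by_cases hex : (∃ (W' : WeierstrassCurve ℚ) (d : ℤ), W'.IsElliptic ∧ W'.IsGloballyMinimal ∧
      (d = -3) ∧ IsIsogenous W (W'.quadraticTwist (d : ℚ)) ∧ ¬ 3 ^ 2 ∣ W'.conductorNorm ℤ)
  · exact maninLocalTwoThree_maninPrimeToThreeAtNine_twistCovered hM hAU hC hnf W D hopt h9 hex
  · exact h₂ hM hAU hC hnf W D hopt h9 hex

/-- **Crux C3 ⟸ the two registered `ternary-twist` twist-minimal stubs** (split by the irreducibility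
of `W[3]`, `WeierstrassCurve.HasIrreducibleModPGaloisRep 3`): `stub_twistMinimalAtThree_irreducible`
(bears on the es lens' E-es-18 `KatoShiftTwistManinThree`) and `stub_twistMinimalAtThree_reducible`
(the `3`-isogeny residual), verbatim as hypotheses. [cite: Stevens1989, Lemmas (5.2), (5.4)]
[cite: CesnaviciusNeururerSaha2023, Thm. 1.2] -/
theorem maninLocalTwoThree_maninPrimeToThreeAtNine_of_twistMinimalAtThree_split
    (hirr : Literature.NumberTheory.EllipticCurves.ModularForms.mazur_not_dvd_maninConstant_of_odd →
      Literature.NumberTheory.EllipticCurves.ModularForms.abbesUllmo_not_dvd_maninConstant_of_not_dvd_level →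
      Literature.NumberTheory.EllipticCurves.ModularForms.cesnavicius_not_two_dvd_maninConstant_of_two_dvd_level →
      Literature.NumberTheory.EllipticCurves.ModularForms.exists_isNewformOf →
      ∀ (W : WeierstrassCurve ℚ) [W.IsElliptic] [W.IsGloballyMinimal] {N : ℕ} [NeZero N]
        (D : ModularParametrizationData W N),
        (∀ z ∈ D.L.lattice, ∃ w ∈ periodLattice D.f, z = D.c * w) → 3 ^ 2 ∣ N →
        ¬ (∃ (W' : WeierstrassCurve ℚ) (d : ℤ), W'.IsElliptic ∧ W'.IsGloballyMinimal ∧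
          (d = -3) ∧ IsIsogenous W (W'.quadraticTwist (d : ℚ)) ∧
          ¬ 3 ^ 2 ∣ W'.conductorNorm ℤ) →
        W.HasIrreducibleModPGaloisRep 3 →
        ¬ (3 : ℤ) ∣ D.maninConstant)
    (hred : Literature.NumberTheory.EllipticCurves.ModularForms.mazur_not_dvd_maninConstant_of_odd →
      Literature.NumberTheory.EllipticCurves.ModularForms.abbesUllmo_not_dvd_maninConstant_of_not_dvd_level →
      Literature.NumberTheory.EllipticCurves.ModularForms.cesnavicius_not_two_dvd_maninConstant_of_two_dvd_level →
      Literature.NumberTheory.EllipticCurves.ModularForms.exists_isNewformOf →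
      ∀ (W : WeierstrassCurve ℚ) [W.IsElliptic] [W.IsGloballyMinimal] {N : ℕ} [NeZero N]
        (D : ModularParametrizationData W N),
        (∀ z ∈ D.L.lattice, ∃ w ∈ periodLattice D.f, z = D.c * w) → 3 ^ 2 ∣ N →
        ¬ (∃ (W' : WeierstrassCurve ℚ) (d : ℤ), W'.IsElliptic ∧ W'.IsGloballyMinimal ∧
          (d = -3) ∧ IsIsogenous W (W'.quadraticTwist (d : ℚ)) ∧
          ¬ 3 ^ 2 ∣ W'.conductorNorm ℤ) →
        ¬ W.HasIrreducibleModPGaloisRep 3 →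
        ¬ (3 : ℤ) ∣ D.maninConstant) :
    Summit.BirchSwinnertonDyer.BirchSwinnertonDyer.Theses.ManinLocalTwoThree.ManinPrimeToThreeAtNine :=
  maninLocalTwoThree_maninPrimeToThreeAtNine_of_twistMinimalAtThree
    fun hM hAU hC hnf W _ _ _ _ D hopt h9 hex ↦ by
      by_cases h : W.HasIrreducibleModPGaloisRep 3
      · exact hirr hM hAU hC hnf W D hopt h9 hex h
      · exact hred hM hAU hC hnf W D hopt h9 hex h

end Summit.BirchSwinnertonDyer.BirchSwinnertonDyer.Theorems

end
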